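import Literature.AnabelianGeometry.SemiGraphs.WitnessIwahoriCoherentCor39
import Literature.AnabelianGeometry.SemiGraphs.UniversalCoveringInfinite
import HarnessLib

/-!
# [SemiAnbd] Cor. 3.9 up to twist at a kernel-certified INFINITE, locally finite carrier (NV certificate)

Mochizuki, *Semi-graphs of anabelioids*, Publ. RIMS **42** (2006), §3, Corollary 3.9 pp. 42–43
[cite: MochizukiSemiAnbd2006, Cor 3.9 pp.42-43] (the consumer shape of [EtTh] §1: the bi-infinite chain
`Y → X` over the punctured Tate curve, i.e. the universal graph-covering of a one-vertex one-loop dual graph).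

PROOF-ONLY (cell abc-iut, layer L3, XS row «COR39@G1∞-NV», L3-lead γ71 (2); seat abc-iut-w6-d120 gen 5;
no definition, no new named fact).  The cell's ∀-countable typings of Cor. 3.9 (`Cor39` F-1710,
`Cor39Compat` F-2771) are REFUTED AS TYPED; the hypothesis-free regime forms hold at finite graphs and at the
universal graph-coverings of finite coherent Cor-3.9 graphs — at the Iwahori chains `𝒢₁(p)_∞` by
abc-iut-w6-d120's `cor39UpToTwistAt_univCover_loopGraph` (p465321).  With `UniversalCoveringInfinite.lean`
(p492884: `𝒢₁,∞` is an INFINITE, locally finite graph) this file packages the one sentence the F-1710 / F-2771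
honest column lacked:

* ★ `IwahoriWitness.exists_infinite_locallyFinite_cor39_graph` — there is a countable, INFINITE, locally
  finite semi-graph of anabelioids satisfying the hypotheses of Cor. 3.9 at which, for EVERY pair of charts,
  Cor. 3.9 up to twist holds with NO hypothesis: (a) a homomorphism induced up to twist by a locally open
  endomorphism is compatibly quasi-geometric; (b) every compatibly quasi-geometric homomorphism is so induced,
  uniquely on underlying semi-graphs (the self-pair `𝒢₁(2)_∞ ↔ 𝒢₁(2)_∞` of p465321);
* `IwahoriWitness.exists_infinite_locallyFinite_cor39_pair` — the two-carrier form: for all primes `p, q`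
  the pair of INFINITE locally finite chains `𝒢₁(p)_∞ ↔ 𝒢₁(q)_∞` carries Cor. 3.9 up to twist, every pair
  of charts, no hypothesis.
* v2 (append-only): `IwahoriWitness.edgeLikeCentralizerAt_univCover_loopGraph` — the Cor. 3.9 proof step
  (R3c) `EdgeLikeCentralizerAt` (FACT-LIST F-2772) HOLDS hypothesis-free at every chart of `𝒢₁(p)_∞` (from
  Thm. 3.7 (iii) there, p463098, via abc-iut-L3-d4's `edgeLikeCentralizerAt_of_compactInVerticialAt`), and the
  packaged `IwahoriWitness.exists_infinite_locallyFinite_edgeLikeCentralizerAt_graph`.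

Honest framing: instance ≠ ∀-closure (both ∀-closures stay refuted, `not_cor39`, `not_cor39Compat`); statements
about OUR typed objects; nothing here takes a side on [IUTchIII] Cor. 3.12; typed ≠ proved elsewhere.
-/

noncomputable section

namespace Literature.AnabelianGeometry.SemiGraphs

namespace IwahoriWitness

open CategoryTheory ProfiniteSemiGraph

/-- ★ **NV certificate for [SemiAnbd] Cor. 3.9 at an INFINITE carrier**: there is a countable, INFINITE,
locally finite semi-graph of anabelioids satisfying the hypotheses of Cor. 3.9 (namely `𝒢₁(2)_∞`, the
universal graph-covering of the Iwahori loop) at which, for every pair of charts `c, c'` of its tempered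
fundamental group, Cor. 3.9 up to twist holds with NO hypothesis — (a) induced-up-to-twist by a locally open
`Φ` ⇒ compatibly quasi-geometric; (b) compatibly quasi-geometric ⇒ induced up to twist by a locally open `Φ`,
unique on underlying semi-graphs (p465321 at the self-pair, p492884 for infinitude and local finiteness,
BY NAME). [cite: MochizukiSemiAnbd2006, Cor 3.9 pp.42-43] -/
theorem exists_infinite_locallyFinite_cor39_graph :
    ∃ 𝒢 : ProfiniteSemiGraph.{0}, Cor39Hypotheses 𝒢 ∧ Infinite 𝒢.graph.Vertex ∧ 𝒢.graph.IsLocallyFinite ∧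
      ∀ (c c' : TemperedPiChart 𝒢),
        (∀ Φ : Hom 𝒢 𝒢, Φ.IsLocallyOpen → ∀ φ : c.G →ₜ* c'.G,
            (∃ θ : Φ.ConjugatorFamily, Nonempty (Φ.chartPullbackWith θ c c' ≅ BTemp.res φ)) →
              IsCompatiblyQuasiGeometric φ) ∧
        ∀ φ : c.G →ₜ* c'.G, IsCompatiblyQuasiGeometric φ →
          ∃ Φ : Hom 𝒢 𝒢, Φ.IsLocallyOpen ∧
            (∃ θ : Φ.ConjugatorFamily, Nonempty (Φ.chartPullbackWith θ c c' ≅ BTemp.res φ)) ∧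
            ∀ Φ' : Hom 𝒢 𝒢, Φ'.IsLocallyOpen →
              (∃ θ' : Φ'.ConjugatorFamily, Nonempty (Φ'.chartPullbackWith θ' c c' ≅ BTemp.res φ)) →
                Φ'.base.vertexMap = Φ.base.vertexMap ∧ Φ'.base.edgeMap = Φ.base.edgeMap := by
  haveI : Fact (Nat.Prime 2) := ⟨Nat.prime_two⟩
  let V₀ : (CovObj.trivialCov (loopGraph 2) PUnit.{1}).OVertex := Quot.mk _ ⟨PUnit.unit, PUnit.unit⟩
  exact ⟨_, cor39Hypotheses_univCover_loopGraph 2 V₀, infinite_vertex_univCover_loopGraph 2 V₀,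
    isLocallyFinite_univCover_loopGraph 2 V₀, fun c c' => cor39UpToTwistAt_univCover_loopGraph 2 2 V₀ V₀ c c'⟩

/-- **The two-carrier form** ([EtTh] §1 shape `Y ↔ Y′`): for all primes `p, q` and base orbits, BOTH Iwahori
chains `𝒢₁(p)_∞`, `𝒢₁(q)_∞` are INFINITE locally finite Cor-3.9 graphs and Cor. 3.9 up to twist holds between
them for every pair of charts, with no hypothesis (p465321 + p492884, BY NAME).
[cite: MochizukiSemiAnbd2006, Cor 3.9 pp.42-43] -/
theorem exists_infinite_locallyFinite_cor39_pair (p q : ℕ) [Fact p.Prime] [Fact q.Prime]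
    (V₀ : (CovObj.trivialCov (loopGraph p) PUnit.{1}).OVertex)
    (W₀ : (CovObj.trivialCov (loopGraph q) PUnit.{1}).OVertex) :
    let 𝒢 := ((CovObj.trivialCov (loopGraph p) PUnit.{1}).univCoverOver (Sum.inl V₀)
        (loopGraph_thm37Hypotheses p).isCountable).coveringGraph
    let ℋ := ((CovObj.trivialCov (loopGraph q) PUnit.{1}).univCoverOver (Sum.inl W₀)
        (loopGraph_thm37Hypotheses q).isCountable).coveringGraph
    (Cor39Hypotheses 𝒢 ∧ Infinite 𝒢.graph.Vertex ∧ 𝒢.graph.IsLocallyFinite) ∧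
    (Cor39Hypotheses ℋ ∧ Infinite ℋ.graph.Vertex ∧ ℋ.graph.IsLocallyFinite) ∧
      ∀ (c : TemperedPiChart 𝒢) (c' : TemperedPiChart ℋ),
        (∀ Φ : Hom 𝒢 ℋ, Φ.IsLocallyOpen → ∀ φ : c.G →ₜ* c'.G,
            (∃ θ : Φ.ConjugatorFamily, Nonempty (Φ.chartPullbackWith θ c c' ≅ BTemp.res φ)) →
              IsCompatiblyQuasiGeometric φ) ∧
        ∀ φ : c.G →ₜ* c'.G, IsCompatiblyQuasiGeometric φ →
          ∃ Φ : Hom 𝒢 ℋ, Φ.IsLocallyOpen ∧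
            (∃ θ : Φ.ConjugatorFamily, Nonempty (Φ.chartPullbackWith θ c c' ≅ BTemp.res φ)) ∧
            ∀ Φ' : Hom 𝒢 ℋ, Φ'.IsLocallyOpen →
              (∃ θ' : Φ'.ConjugatorFamily, Nonempty (Φ'.chartPullbackWith θ' c c' ≅ BTemp.res φ)) →
                Φ'.base.vertexMap = Φ.base.vertexMap ∧ Φ'.base.edgeMap = Φ.base.edgeMap :=
  ⟨⟨cor39Hypotheses_univCover_loopGraph p V₀, infinite_vertex_univCover_loopGraph p V₀,
      isLocallyFinite_univCover_loopGraph p V₀⟩,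
    ⟨cor39Hypotheses_univCover_loopGraph q W₀, infinite_vertex_univCover_loopGraph q W₀,
      isLocallyFinite_univCover_loopGraph q W₀⟩,
    fun c c' => cor39UpToTwistAt_univCover_loopGraph p q V₀ W₀ c c'⟩

/-! ### v2 (append-only): the Cor. 3.9 proof step (R3c) `EdgeLikeCentralizerAt` (F-2772) at `𝒢₁,∞` -/

/-- ★ **(R3c) F-2772 `EdgeLikeCentralizerAt` HOLDS, hypothesis-free, at every chart of the INFINITE locally
finite Cor-3.9 graph `𝒢₁(p)_∞`** (the universal graph-covering of the Iwahori loop; every prime `p`, every base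
orbit): from Thm. 3.7 (iii) AT `𝒢₁,∞` (`compactInVerticialAt_univCover_loopGraph`, p463098) and the Cor-3.9
hypotheses there (p465321) through abc-iut-L3-d4's `edgeLikeCentralizerAt_of_compactInVerticialAt`, BY NAME —
an instance of F-2772 at a kernel-certified infinite carrier (p492884), complementing the class closers
(no-core p482284, no-hostable-core p486373, top-cyclic p493572). [cite: MochizukiSemiAnbd2006, Cor 3.9 p.43] -/
theorem edgeLikeCentralizerAt_univCover_loopGraph (p : ℕ) [Fact p.Prime]
    (V₀ : (CovObj.trivialCov (loopGraph p) PUnit.{1}).OVertex)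
    (c : TemperedPiChart ((CovObj.trivialCov (loopGraph p) PUnit.{1}).univCoverOver (Sum.inl V₀)
      (loopGraph_thm37Hypotheses p).isCountable).coveringGraph) :
    EdgeLikeCentralizerAt ((CovObj.trivialCov (loopGraph p) PUnit.{1}).univCoverOver (Sum.inl V₀)
      (loopGraph_thm37Hypotheses p).isCountable).coveringGraph c :=
  edgeLikeCentralizerAt_of_compactInVerticialAt (compactInVerticialAt_univCover_loopGraph p V₀)
    (cor39Hypotheses_univCover_loopGraph p V₀) c

/-- **NV certificate for F-2772 at an INFINITE carrier**: there is a countable, INFINITE, locally finite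
Cor-3.9 graph at which `EdgeLikeCentralizerAt` holds at EVERY chart with no hypothesis (`𝒢₁(2)_∞`).
[cite: MochizukiSemiAnbd2006, Cor 3.9 p.43] -/
theorem exists_infinite_locallyFinite_edgeLikeCentralizerAt_graph :
    ∃ 𝒢 : ProfiniteSemiGraph.{0}, Cor39Hypotheses 𝒢 ∧ Infinite 𝒢.graph.Vertex ∧ 𝒢.graph.IsLocallyFinite ∧
      ∀ c : TemperedPiChart 𝒢, EdgeLikeCentralizerAt 𝒢 c := by
  haveI : Fact (Nat.Prime 2) := ⟨Nat.prime_two⟩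
  let V₀ : (CovObj.trivialCov (loopGraph 2) PUnit.{1}).OVertex := Quot.mk _ ⟨PUnit.unit, PUnit.unit⟩
  exact ⟨_, cor39Hypotheses_univCover_loopGraph 2 V₀, infinite_vertex_univCover_loopGraph 2 V₀,
    isLocallyFinite_univCover_loopGraph 2 V₀, edgeLikeCentralizerAt_univCover_loopGraph 2 V₀⟩

end IwahoriWitness

end Literature.AnabelianGeometry.SemiGraphs

end
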